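import Summits.AtomisticToContinuum.Crystallization.Theses.ExcessDecayLiouville

/-!
# Sketch — crux idea `repair-stable-morphology` (CoarseGrains, stmt-AtomisticToContinuum-9331; round 1, ideator 3, gen 2)

First lemmas of the card as `Prop`s over existing declarations (statements only; nothing here is
claimed proved).  The chain is

  `StableDichotomy → BulkGap → UpperBound → BarlowCoarseGrains (1/40)`      (`MorphologyBridge`)
  `ApproxCoercivity eRef γ κ ∧ TrialUpper eRef ∧ γ < κ f₀  ⇒  BulkGap at f₀`   (`ApproxGivesBulk`)
  `(∀ η > 0, BarlowCoarseGrains η) → ExcessDecayLiouville.CoarseGrains`        (`HcpSelection`, cards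
                                                                                hagg-parity / shockley-sweep)

`StableDichotomy` is the load-bearing NEW statement (minimality used as relocation-stability under
explicit repair surgeries inside certified-good regions); `BulkGap` / `ApproxCoercivity` is what is
left of the Kepler-type energetic core: coercivity only for configurations with a MACROSCOPIC
fraction of coarse-bad particles, i.e. an approximate certificate with R-independent precision.
-/

noncomputable section

open Literature.MathematicalPhysics.StatisticalMechanics

namespace Summit.AtomisticToContinuum.Crystallization.Cruxes.CoarseGrains.IdeatorThreeG2

/-- `ℝ³`. -/
abbrev E3 := EuclideanSpace ℝ (Fin 3)

/-- The periodic infimum `e* = ⨅_Q e(Q)` of the Lennard-Jones energy per particle (the reference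
against which the floor `N·e* ≤ 𝓔(x)` is free by padding periodisation). -/
def eStar : ℝ := ⨅ Q : PeriodicConfiguration 3, Q.energyPerParticle lennardJones

/-- Admissible cell with WINDOW `w`: within `w` (operator norm) of `0.97·O`, `O` a linear isometry.  `w = 1/40`
is the crux's `Adm` verbatim; the local badness predicate uses the WIDE window `w = 1/10`, so that strain between
the two windows is never priced by a certificate (it is returned to `1/40` by criticality + regularity, step S4). -/
def AdmW (w : ℝ) (A : E3 →L[ℝ] E3) : Prop :=
  ∃ O : E3 ≃ₗᵢ[ℝ] E3, ‖A - (97 / 100 : ℝ) • (O.toContinuousLinearEquiv : E3 →L[ℝ] E3)‖ ≤ w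

/-- The crux's admissible cell (`w = 1/40`). -/
def Adm (A : E3 →L[ℝ] E3) : Prop := AdmW (1 / 40) A

/-- BARLOW-AGNOSTIC GOOD BALL with window `w` and tolerance `η`: `X` is two-way `η`-matched on the closed
ball `B_R(c)` with an AFFINE image `v + A(barlowStacking 1 √(2/3) s)`, `AdmW w A`, of the ideal Barlow stacking
of SOME Hägg word `s` (the crux's own two-way matching; hcp = the alternating word; `w = 1/40` = the crux's
window). -/
def GoodBall (w : ℝ) (X : Set E3) (c : E3) (R η : ℝ) : Prop :=
  ∃ s : ℤ → ℤ, IsHaggSeq s ∧ ∃ A : E3 →L[ℝ] E3, AdmW w A ∧ ∃ v : E3,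
    (∀ p ∈ X, dist p c ≤ R → ∃ q ∈ barlowStacking 1 (Real.sqrt (2 / 3)) s, dist p (v + A q) ≤ η) ∧
    (∀ q ∈ barlowStacking 1 (Real.sqrt (2 / 3)) s, dist (v + A q) c ≤ R →
      ∃ p ∈ X, dist p (v + A q) ≤ η)

/-- COARSE LOCAL BADNESS: particle `i` is bad iff its radius-`2` environment is NOT a good ball at
the crux tolerance `1/40` for the WIDE window `1/10` (one fixed radius, one fixed coarse tolerance, strain up to
`10 %` allowed — no `θ → 0`, no `R`). -/
def LocBad {N : ℕ} (x : Fin N → E3) (i : Fin N) : Prop :=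
  ¬ GoodBall (1 / 10) (Set.range x) (x i) 2 (1 / 40)

/-- BARLOW COARSE GRAINS at tolerance `η` (the stacking-agnostic shadow of the crux): every large
Lennard-Jones ground state contains a good ball of every radius, IN THE CRUX WINDOW `1/40`. -/
def BarlowCoarseGrains (η : ℝ) : Prop :=
  ∀ R : ℝ, 0 < R → ∃ N₀ : ℕ, ∀ N : ℕ, N₀ ≤ N → ∀ x : Fin N → E3,
    IsGroundState lennardJones x → ∃ c : E3, GoodBall (1 / 40) (Set.range x) c R η

/-- **STABLE DICHOTOMY (the card's load-bearing first lemma; morphology by repair surgery).**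
There is ONE fraction `f₀ > 0`, independent of the radius, such that for every `R` every large
Lennard-Jones ground state EITHER contains a `(1/40)`-good Barlow ball of radius `R` OR has at least
`f₀·N` coarse-bad particles.  Content: a ground state is stable under every particle-conserving
relocation; cashed through (i) condensation of vacancies / interstitials of a certified-good region
into one void / one extra island (sublinear cost ⇒ at most `M₀ ≈ 50` point defects per coherent
region of ANY size), (ii) coherent refill of embedded bad inclusions with JOINT condensation of their
particle deficits, (iii) recrystallisation of balls of radius `∝ R` (kills thin-walled bad networks,
high- and low-angle polycrystals — the latter via a Read–Shockley-type rigidity LOWER bound,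
Lauteri–Luckhaus) and reconnection of dislocation networks, (iv) criticality + interior regularity on
the resulting coherent defect-free region (route support ExcessDecay, line interior-oscillation-decay)
— every energy comparison being perturbative around a KNOWN lattice inside the good region. -/
def StableDichotomy : Prop :=
  ∃ f₀ : ℝ, 0 < f₀ ∧ ∀ R : ℝ, 0 < R → ∃ N₀ : ℕ, ∀ N : ℕ, N₀ ≤ N → ∀ x : Fin N → E3,
    IsGroundState lennardJones x →
      (∃ c : E3, GoodBall (1 / 40) (Set.range x) c R (1 / 40)) ∨
        f₀ * (N : ℝ) ≤ (Nat.card {i : Fin N // LocBad x i} : ℝ)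

/-- **BULK GAP (what remains of the energetic core).** Configurations with a MACROSCOPIC fraction
`f₀` of coarse-bad particles are macroscopically non-minimal: `𝓔(x) ≥ N(e* + g) − C N^{2/3}`.  No
statement about configurations with few bad particles (mild / dilute / point / line defects are the
business of `StableDichotomy`, not of the certificate). -/
def BulkGap : Prop :=
  ∀ f₀ : ℝ, 0 < f₀ → ∃ g C : ℝ, 0 < g ∧ ∀ (N : ℕ) (x : Fin N → E3), Function.Injective x →
    f₀ * (N : ℝ) ≤ (Nat.card {i : Fin N // LocBad x i} : ℝ) →
      (N : ℝ) * (eStar + g) - C * (N : ℝ) ^ ((2 : ℝ) / 3) ≤ interactionEnergy lennardJones x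

/-- APPROXIMATE COERCIVE CERTIFICATE with reference energy `eRef` (in practice `e(hcp a* h*)`),
precision `γ` and coarse coercivity constant `κ`: `N(eRef − γ) + κ·#Bad ≤ 𝓔(x)` for every injective
`x`.  With `TrialUpper eRef` and `γ < κ f₀` it yields `BulkGap` at `f₀` — the precision needed is
`γ ≈ κ f₀`, INDEPENDENT of the grain radius `R` (estimate: κ ≈ 5·10⁻³ bound by the cheapest
non-Barlow bulk phase, f₀ a fixed fraction; so γ ≈ 10⁻³ absolute at radius 2, tolerance 1/40). -/
def ApproxCoercivity (eRef γ κ : ℝ) : Prop :=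
  ∀ (N : ℕ) (x : Fin N → E3), Function.Injective x →
    (N : ℝ) * (eRef - γ) + κ * (Nat.card {i : Fin N // LocBad x i} : ℝ) ≤
      interactionEnergy lennardJones x

/-- Trial upper bound at the reference energy (= line C's `stub_trialBound` / CrysEnergyUpper shape). -/
def TrialUpper (eRef : ℝ) : Prop :=
  ∃ C : ℝ, ∀ N : ℕ, groundStateEnergy lennardJones 3 N ≤ (N : ℝ) * eRef + C * (N : ℝ) ^ ((2 : ℝ) / 3)

/-- `limsup E(N)/N ≤ e*` in `ε`-form (free from trial periodic blocks). -/
def UpperBound : Prop :=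
  ∀ ε : ℝ, 0 < ε → ∃ N₀ : ℕ, ∀ N : ℕ, N₀ ≤ N →
    groundStateEnergy lennardJones 3 N ≤ (N : ℝ) * (eStar + ε)

/-- The morphology bridge (bookkeeping: the bad-fraction branch contradicts near-minimality). -/
def MorphologyBridge : Prop :=
  StableDichotomy → BulkGap → UpperBound → BarlowCoarseGrains (1 / 40)

/-- From an approximate certificate to the bulk gap at a given fraction (bookkeeping: `e* ≤ eRef`
by `TrialUpper` + the free floor, then `κ f₀ − γ > 0`). -/
def ApproxGivesBulk : Prop :=
  ∀ eRef γ κ f₀ : ℝ, 0 < κ → 0 ≤ γ → 0 < f₀ → γ < κ * f₀ →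
    ApproxCoercivity eRef γ κ → TrialUpper eRef →
      ∃ g C : ℝ, 0 < g ∧ ∀ (N : ℕ) (x : Fin N → E3), Function.Injective x →
        f₀ * (N : ℝ) ≤ (Nat.card {i : Fin N // LocBad x i} : ℝ) →
          (N : ℝ) * (eStar + g) - C * (N : ℝ) ^ ((2 : ℝ) / 3) ≤ interactionEnergy lennardJones x

/-- HCP SELECTION (cards hagg-parity-involution-surgery / shockley-sweep-stacking-selection + the
iso-dictionary of line vanishing-excess-truss-rigidity; fine tolerance is supplied by step (iv) of
`StableDichotomy`, interior regularity on a coherent defect-free region): fine Barlow grains of every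
radius give the crux. -/
def HcpSelection : Prop :=
  (∀ η : ℝ, 0 < η → BarlowCoarseGrains η) →
    Summit.AtomisticToContinuum.Crystallization.Theses.ExcessDecayLiouville.CoarseGrains

/-- Sanity: monotonicity of good balls in the tolerance (used silently when fine grains are
coarsened to `1/40`). -/
theorem goodBall_mono {w : ℝ} {X : Set E3} {c : E3} {R η η' : ℝ} (hη : η ≤ η')
    (h : GoodBall w X c R η) : GoodBall w X c R η' := by
  obtain ⟨s, hs, A, hA, v, h1, h2⟩ := h
  refine ⟨s, hs, A, hA, v, fun p hp hpc => ?_, fun q hq hqc => ?_⟩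
  · obtain ⟨q, hq, hd⟩ := h1 p hp hpc
    exact ⟨q, hq, hd.trans hη⟩
  · obtain ⟨p, hp, hd⟩ := h2 q hq hqc
    exact ⟨p, hp, hd.trans hη⟩

/-- Sanity: fine Barlow grains at every tolerance give the coarse ones. -/
theorem barlowCoarseGrains_of_fine (h : ∀ η : ℝ, 0 < η → BarlowCoarseGrains η) :
    BarlowCoarseGrains (1 / 40) :=
  h _ (by norm_num)

end Summit.AtomisticToContinuum.Crystallization.Cruxes.CoarseGrains.IdeatorThreeG2

end
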